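import Summits.QuantumFields.BalabanUV.Beta.GAN24.RespStepBmDecompPsi
import Summits.QuantumFields.BalabanUV.Beta.GAN24.RespStepDecay
import Summits.QuantumFields.BalabanUV.Beta.GAN24.Push4LegMoves

/-!
# `BalabanUV.Beta.GAN24.UndressedResponseUnits` — binder row G-an2-4 / (CONV-C), the row OWNER's CONTACT-TERM ROUTE (`gan24-p1` gen 17,
# `CT-ROUTE-v1.md` §3; INTERFACE REQUEST G-an2-4 (B)), input of CT-2 ∕ CT-3: **THE UNDRESSED COMPOSITE RESPONSE `T^B_{m→m+k+1} = respStep (Lc^m) (Lc^(m+k+1))`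
# ACTING ON BOUNDED DATA — SUP `≤ K·(Lc^{5(k+1)})⁻¹·sup|b|` AND UNIT GRADIENT `≤ K′·(Lc^{6(k+1)})⁻¹·sup|b|`, UNIFORMLY IN THE PAIR OF LEVELS** (`d = 3`)

NOT IN PRINT; OUR BOOKKEEPING (G-an2-4 formalisation swarm, leaf prover `b2b-balaban-gan24-formalise-leaf-01`, gen 57; file A of the CT-2 triple
A `UndressedResponseUnits` → B `DressedLegUnits` → C `DressedLegEnvelope`).  HONEST FRAMING (cell contract, verbatim): «discharging `BetaPertH` makes
Bałaban's UV stability UNCONDITIONAL — a real constructive-QFT result; it is NOT the continuum limit and NOT the Clay problem.»  HONEST DEPENDENCY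
(verbatim): «continuum YM on T⁴ ⇐ BetaPertH ∧ nine spine estimates (0/9 proved); BetaPertH ⇐ (D1) ∧ (D4) ∧ CAP+tail; G-an2-4 gates asym, D1 and NE2/3/4.»

THE ONE TREE INPUT (BY NAME): leaf-12-g20's UNIFORM ONE-SHOT LETTER `RespStepDecay.exists_respStep_decay_and_grad` (`d = 3`, on leaf-16's (N1)
`FineReadoutDecay` and leaf-19's (N1′)): ONE `κ₀ > 0`, `C, C′ ≥ 0` with `|respStep (Lc^m) (Lc^(m+k+1)) μ z l″ w′| ≤ C·((Lc^(k+1))^5)⁻¹·e^{−κ₀‖quo (Lc^(k+1)) w′ − z‖∞}`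
and the unit-gradient twin with `C′·((Lc^(k+1))^6)⁻¹`, for ALL `m, k` — the undressed COMPOSITE response over `k+1` levels is `O(L^{−(d+2)})`, its unit
gradient one `1∕L` better, `L = Lc^(k+1)` the relative blocking.  (The design note's one-STEP K-slot facts `colH_KStepUnit` ∕ `legDecay_respStep_of_decays`
would only give constants compounding with the number of levels; the one-SHOT letter is what makes everything below uniform.)

## Contents ([folklore]; 0 `def`, 0 `def … : Prop`, 0 cited facts, 0 sorry)
* §1 (generic `d`): `abs_mul_le_of_envelope` ∕ **`abs_legAct_le_of_envelope`** — a leg family with the `ℓ∞`-block envelope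
  `|R μ y κ u| ≤ E·e^{−κ₀‖quo L u − y‖∞}` acts on bounded data with `|legAct R b κ u| ≤ (d+1)·E·Zl_{d+1}(κ₀∕(d+1))·sup|b|` (an `ℓ∞` envelope is an `ℓ¹`
  one at rate `κ₀∕(d+1)`: leaf-17's `Push4LegMoves.exp_supNorm_le_exp_l1` ∕ `abs_tsum_le_of_shift` BY NAME); `summable_mul_of_envelope`;
  **`legAct_shift_sub`** (a shift of the fine argument passes to the legs); `inv_cast_pow_pow` (units bookkeeping across the cast).
* §2 (`d = 3`, `[NeZero Lc]`, every `Lc ≥ 1`): **`exists_abs_legAct_respStep_le`** and **`exists_abs_legAct_respStep_shift_sub_le`** — the two letters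
  above, constants OUTSIDE every `∀` (the interior gradient letter is the one CT-3's summation by parts reads on the UNDRESSED legs).
HONEST: `U = 1`, `d = 3`; constants existential (functions of `Lc` and of the letter's `κ₀, C, C′`); zeroth and first order only; discharges NO binder of
(CONV-C), 0 wall binders; NEVER «G-an2-4 closed»; NOT D1, NOT BetaPertH, NOT continuum, NOT Clay.
-/

noncomputable section

open Finset
open scoped BigOperators
open Literature.MathematicalPhysics.QuantumFieldTheory
open Literature.MathematicalPhysics.QuantumFieldTheory.LatticeForm (quo)
open Literature.MathematicalPhysics.QuantumFieldTheory.Balaban1983to89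
open Literature.MathematicalPhysics.QuantumFieldTheory.Balaban1983to89.Beta
open B12Sec2to5 (l1)
open B4ContourShift (supNorm)
open ExpKernelCalculus (Zl Zl_nonneg l1_sub_symm)
open AffineAveraging (Form0 Form1 Site box toSite unitVec dz)
open BalabanCompositeJets (respStep)
open Summit.QuantumFields.BalabanUV.Beta.GAN24.Push4Iter (LegFam)
open Summit.QuantumFields.BalabanUV.Beta.GAN24.RespStepBmDecompLegs (legAct legAct_apply)
open Summit.QuantumFields.BalabanUV.Beta.GAN24.RespStepDecay (exists_respStep_decay_and_grad)
open Summit.QuantumFields.BalabanUV.Beta.GAN24.Push4LegMoves (exp_supNorm_le_exp_l1 abs_tsum_le_of_shift)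

namespace Summit.QuantumFields.BalabanUV.Beta.GAN24.UndressedResponseUnits

variable {d : ℕ}

/-! ## §1 Legs with an `ℓ∞`-block envelope acting on bounded data (generic dimension) -/

/-- [folklore] The pointwise majorant behind the next two lemmas: an `ℓ∞`-block envelope on the legs and bounded data give
`|b μ y · R μ y κ w| ≤ β·E·e^{−(κ₀∕(d+1))|y − quo L w|₁}` (leaf-17's `Push4LegMoves.exp_supNorm_le_exp_l1` BY NAME). -/
theorem abs_mul_le_of_envelope {R : LegFam d} {b : Form1 (d + 1) ℝ} {E κ₀ β : ℝ} {L : ℕ} (hE : 0 ≤ E) (hκ : 0 < κ₀)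
    (hR : ∀ μ y κ u, |R μ y κ u| ≤ E * Real.exp (-(κ₀ * supNorm (quo L u - y))))
    (hb : ∀ μ y, |b μ y| ≤ β) (μ : Fin (d + 1)) (y : Site (d + 1)) (κ : Fin (d + 1)) (w : Site (d + 1)) :
    |b μ y * R μ y κ w| ≤ β * E * Real.exp (-(κ₀ / ((d : ℝ) + 1)) * l1 (y - quo L w)) := by
  have hβ : 0 ≤ β := (abs_nonneg _).trans (hb 0 0)
  have hd : (0 : ℝ) < (d : ℝ) + 1 := by positivity
  have hle : κ₀ / ((d : ℝ) + 1) * ((d : ℝ) + 1) ≤ κ₀ := by rw [div_mul_cancel₀ _ hd.ne']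
  have h := exp_supNorm_le_exp_l1 (div_pos hκ hd).le hle (quo L w - y)
  rw [l1_sub_symm] at h
  rw [abs_mul]
  calc |b μ y| * |R μ y κ w| ≤ β * (E * Real.exp (-(κ₀ * supNorm (quo L w - y)))) :=
        mul_le_mul (hb μ y) (hR μ y κ w) (abs_nonneg _) hβ
    _ ≤ β * (E * Real.exp (-(κ₀ / ((d : ℝ) + 1)) * l1 (y - quo L w))) :=
        mul_le_mul_of_nonneg_left (mul_le_mul_of_nonneg_left h hE) hβ
    _ = _ := by ring

/-- [folklore] **A LEG FAMILY WITH AN `ℓ∞`-BLOCK ENVELOPE ACTS BOUNDEDLY ON BOUNDED DATA**: if `|R μ y κ u| ≤ E·e^{−κ₀‖quo L u − y‖∞}`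
(`E ≥ 0`, `κ₀ > 0`) and `|b μ y| ≤ β`, then `|legAct R b κ u| ≤ (d+1)·E·Zl_{d+1}(κ₀∕(d+1))·β` — each of the `d+1` source directions contributes a
series dominated by `β·E·e^{−(κ₀∕(d+1))|quo L u − y|₁}`, summed by `ExpKernelCalculus.tsum_exp_shift`. -/
theorem abs_legAct_le_of_envelope {R : LegFam d} {b : Form1 (d + 1) ℝ} {E κ₀ β : ℝ} {L : ℕ}
    (hE : 0 ≤ E) (hκ : 0 < κ₀)
    (hR : ∀ μ y κ u, |R μ y κ u| ≤ E * Real.exp (-(κ₀ * supNorm (quo L u - y))))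
    (hb : ∀ μ y, |b μ y| ≤ β) (κ : Fin (d + 1)) (u : Site (d + 1)) :
    |legAct R b κ u| ≤ (((d : ℝ) + 1) * E * Zl (d + 1) (κ₀ / ((d : ℝ) + 1))) * β := by
  rw [legAct_apply]
  have hc : 0 < κ₀ / ((d : ℝ) + 1) := div_pos hκ (by positivity)
  have hinner : ∀ μ, |∑' y, b μ y * R μ y κ u| ≤ β * E * Zl (d + 1) (κ₀ / ((d : ℝ) + 1)) := fun μ =>
    abs_tsum_le_of_shift hc (quo L u) fun y => abs_mul_le_of_envelope hE hκ hR hb μ y κ u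
  calc |∑ μ, ∑' y, b μ y * R μ y κ u| ≤ ∑ μ, |∑' y, b μ y * R μ y κ u| := Finset.abs_sum_le_sum_abs _ _
    _ ≤ ∑ _μ : Fin (d + 1), β * E * Zl (d + 1) (κ₀ / ((d : ℝ) + 1)) := Finset.sum_le_sum fun μ _ => hinner μ
    _ = _ := by
        rw [Finset.sum_const, Finset.card_univ, Fintype.card_fin, nsmul_eq_mul]
        push_cast
        ring

/-- [folklore] With an `ℓ∞`-block envelope on the legs and bounded data, every series `y ↦ b μ y · R μ y κ w` is summable. -/
theorem summable_mul_of_envelope {R : LegFam d} {b : Form1 (d + 1) ℝ} {E κ₀ β : ℝ} {L : ℕ} (hE : 0 ≤ E) (hκ : 0 < κ₀)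
    (hR : ∀ μ y κ u, |R μ y κ u| ≤ E * Real.exp (-(κ₀ * supNorm (quo L u - y))))
    (hb : ∀ μ y, |b μ y| ≤ β) (μ κ : Fin (d + 1)) (w : Site (d + 1)) :
    Summable fun y => b μ y * R μ y κ w := by
  have hc : 0 < κ₀ / ((d : ℝ) + 1) := div_pos hκ (by positivity)
  refine Summable.of_norm_bounded ((ExpKernelCalculus.summable_exp_shift' hc (quo L w)).mul_left (β * E)) fun y => ?_
  rw [Real.norm_eq_abs]
  exact abs_mul_le_of_envelope hE hκ hR hb μ y κ w

/-- [folklore] **A UNIT SHIFT OF THE FINE ARGUMENT PASSES TO THE LEGS**: with summable series,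
`legAct R b κ (u + v) − legAct R b κ u = legAct (fun μ y κ′ w ↦ R μ y κ′ (w + v) − R μ y κ′ w) b κ u`. -/
theorem legAct_shift_sub {R : LegFam d} {b : Form1 (d + 1) ℝ} (hs : ∀ μ κ w, Summable fun y => b μ y * R μ y κ w)
    (κ : Fin (d + 1)) (u v : Site (d + 1)) :
    legAct R b κ (u + v) - legAct R b κ u = legAct (fun μ y κ' w => R μ y κ' (w + v) - R μ y κ' w) b κ u := by
  simp only [legAct_apply, ← Finset.sum_sub_distrib]
  refine Finset.sum_congr rfl fun μ _ => ?_
  rw [← Summable.tsum_sub (hs μ κ (u + v)) (hs μ κ u)]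
  exact tsum_congr fun y => by ring

/-- [folklore] Units bookkeeping: `((Lc^(k+1))^n)⁻¹ = (Lc^{n(k+1)})⁻¹` across the cast. -/
theorem inv_cast_pow_pow (Lc k n : ℕ) : ((((Lc ^ (k + 1) : ℕ) : ℝ)) ^ n)⁻¹ = ((Lc : ℝ) ^ (n * (k + 1)))⁻¹ := by
  push_cast
  rw [← pow_mul, mul_comm]

/-! ## §2 `d = 3`: the undressed composite response on bounded data, uniformly -/

section Four

variable {Lc : ℕ} [NeZero Lc]

/-- NOT IN PRINT; OUR BOOKKEEPING.  **THE UNDRESSED COMPOSITE RESPONSE ON BOUNDED DATA, UNIFORMLY IN THE PAIR OF LEVELS** (`d = 3`, every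
`Lc ≥ 1`): ONE `K ≥ 0` with, for ALL `m k`, every datum with `|b μ y| ≤ β` and every fine bond `(κ, u)`,
`|legAct (respStep (Lc^m) (Lc^(m+k+1))) b κ u| ≤ K·(Lc^{5(k+1)})⁻¹·β` — leaf-12's one-shot letter `exists_respStep_decay_and_grad` (clause (N1))
summed against the datum by `abs_legAct_le_of_envelope`. -/
theorem exists_abs_legAct_respStep_le :
    ∃ K : ℝ, 0 ≤ K ∧ ∀ (m k : ℕ) (b : Form1 (3 + 1) ℝ) (β : ℝ), (∀ μ y, |b μ y| ≤ β) →
      ∀ (κ : Fin (3 + 1)) (u : Site (3 + 1)),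
        |legAct (respStep (d := 3) (Lc ^ m) (Lc ^ (m + k + 1))) b κ u| ≤ K * ((Lc : ℝ) ^ (5 * (k + 1)))⁻¹ * β := by
  obtain ⟨κ₀, C, C', hκ₀, hC, -, hN1, -⟩ := exists_respStep_decay_and_grad (Lc := Lc)
  have hZ : 0 ≤ Zl (3 + 1) (κ₀ / (((3 : ℕ) : ℝ) + 1)) := Zl_nonneg (div_pos hκ₀ (by positivity))
  refine ⟨(((3 : ℕ) : ℝ) + 1) * C * Zl (3 + 1) (κ₀ / (((3 : ℕ) : ℝ) + 1)),
    mul_nonneg (mul_nonneg (by positivity) hC) hZ, ?_⟩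
  intro m k b β hb κ u
  have hE : 0 ≤ C * ((Lc : ℝ) ^ (5 * (k + 1)))⁻¹ := by positivity
  have hR : ∀ (μ : Fin (3 + 1)) (y : Site (3 + 1)) (κ' : Fin (3 + 1)) (u' : Site (3 + 1)),
      |respStep (d := 3) (Lc ^ m) (Lc ^ (m + k + 1)) μ y κ' u'| ≤
        (C * ((Lc : ℝ) ^ (5 * (k + 1)))⁻¹) * Real.exp (-(κ₀ * supNorm (quo (Lc ^ (k + 1)) u' - y))) := by
    intro μ y κ' u'
    have h := hN1 m k μ y κ' u'
    rwa [inv_cast_pow_pow] at h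
  have h := abs_legAct_le_of_envelope (d := 3) hE hκ₀ hR hb κ u
  exact h.trans (le_of_eq (by ring))

/-- NOT IN PRINT; OUR BOOKKEEPING.  **THE UNIT GRADIENT OF THE UNDRESSED COMPOSITE RESPONSE ON BOUNDED DATA, UNIFORMLY** (`d = 3`, every
`Lc ≥ 1`): ONE `K′ ≥ 0` with, for ALL `m k`, every datum with `|b μ y| ≤ β`, every fine bond `(κ, u)` and direction `ν`,
`|legAct (respStep (Lc^m) (Lc^(m+k+1))) b κ (u + e_ν) − legAct (respStep (Lc^m) (Lc^(m+k+1))) b κ u| ≤ K′·(Lc^{6(k+1)})⁻¹·β` — ONE power of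
`L = Lc^(k+1)` better than the response itself: leaf-12's clause (N1′) summed against the datum (`legAct_shift_sub` + `abs_legAct_le_of_envelope`);
the interior gradient letter CT-3 reads on the UNDRESSED legs. -/
theorem exists_abs_legAct_respStep_shift_sub_le :
    ∃ K' : ℝ, 0 ≤ K' ∧ ∀ (m k : ℕ) (b : Form1 (3 + 1) ℝ) (β : ℝ), (∀ μ y, |b μ y| ≤ β) →
      ∀ (κ : Fin (3 + 1)) (u : Site (3 + 1)) (ν : Fin (3 + 1)),
        |legAct (respStep (d := 3) (Lc ^ m) (Lc ^ (m + k + 1))) b κ (u + unitVec ν)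
            - legAct (respStep (d := 3) (Lc ^ m) (Lc ^ (m + k + 1))) b κ u| ≤ K' * ((Lc : ℝ) ^ (6 * (k + 1)))⁻¹ * β := by
  obtain ⟨κ₀, C, C', hκ₀, hC, hC', hN1, hN1'⟩ := exists_respStep_decay_and_grad (Lc := Lc)
  have hZ : 0 ≤ Zl (3 + 1) (κ₀ / (((3 : ℕ) : ℝ) + 1)) := Zl_nonneg (div_pos hκ₀ (by positivity))
  refine ⟨(((3 : ℕ) : ℝ) + 1) * C' * Zl (3 + 1) (κ₀ / (((3 : ℕ) : ℝ) + 1)),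
    mul_nonneg (mul_nonneg (by positivity) hC') hZ, ?_⟩
  intro m k b β hb κ u ν
  -- the response itself has an envelope (clause (N1)): every series is summable, so the shift passes to the legs
  have hR : ∀ (μ : Fin (3 + 1)) (y : Site (3 + 1)) (κ' : Fin (3 + 1)) (u' : Site (3 + 1)),
      |respStep (d := 3) (Lc ^ m) (Lc ^ (m + k + 1)) μ y κ' u'| ≤
        (C * ((Lc : ℝ) ^ (5 * (k + 1)))⁻¹) * Real.exp (-(κ₀ * supNorm (quo (Lc ^ (k + 1)) u' - y))) := by
    intro μ y κ' u'
    have h := hN1 m k μ y κ' u'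
    rwa [inv_cast_pow_pow] at h
  have hE₀ : 0 ≤ C * ((Lc : ℝ) ^ (5 * (k + 1)))⁻¹ := by positivity
  rw [legAct_shift_sub (summable_mul_of_envelope hE₀ hκ₀ hR hb) κ u (unitVec ν)]
  -- the shifted-difference legs have the (N1′) envelope
  have hE : 0 ≤ C' * ((Lc : ℝ) ^ (6 * (k + 1)))⁻¹ := by positivity
  have hR' : ∀ (μ : Fin (3 + 1)) (y : Site (3 + 1)) (κ' : Fin (3 + 1)) (u' : Site (3 + 1)),
      |(fun μ y κ' w => respStep (d := 3) (Lc ^ m) (Lc ^ (m + k + 1)) μ y κ' (w + unitVec ν)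
          - respStep (d := 3) (Lc ^ m) (Lc ^ (m + k + 1)) μ y κ' w) μ y κ' u'| ≤
        (C' * ((Lc : ℝ) ^ (6 * (k + 1)))⁻¹) * Real.exp (-(κ₀ * supNorm (quo (Lc ^ (k + 1)) u' - y))) := by
    intro μ y κ' u'
    have h := hN1' m k μ y κ' u' ν
    rwa [inv_cast_pow_pow] at h
  have h := abs_legAct_le_of_envelope (d := 3) hE hκ₀ hR' hb κ u
  exact h.trans (le_of_eq (by ring))

end Four

end Summit.QuantumFields.BalabanUV.Beta.GAN24.UndressedResponseUnits

end
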